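import Literature.MathematicalPhysics.QuantumFieldTheory.Balaban1983to89.Node00.Record13SepCoPInhabitedOfThm1CCMWGaugeR
import Summits.QuantumFields.YangMills.Theorems.BalabanUVNodesK0ROfStepTokensRCube

/-!
# BalabanUVNodes ∕ K0 ROAD — THE WINDOW WEAKENING OF plan g76's V15 STUB 3′: the ⁷ K0 body for `F` (`4 ≤ F.m`) at `N = 2` from [15] Proposition 8's top step, [6] Proposition 6 at
# NODE 00's member, the signs, and the β-box of `betaOfRecord₁₃ F 2 θ₁₅ᶜᶜᴹ(3)` on SOME box `]0, γ] ⊆ ]0, ½]` with `0 ≤ b`, `β′·γ² ≤ ¾` (V15: THE box `]0, ½]`, `β′ ≤ 3`) — and the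
# V16-candidate composition «stub 1 → stub 2 → stub 3ʷ → stub 4 → ∀ F, K0⁷-body» kernel-checked, with `stub 3′ → stub 3ʷ`

Cell `pub-ymgap`, seat `pub-ymgap-dag-n21-c` (g12), pen (γ) on V15 stub 3′ `stub_betaBoxAtThm1WitnessCCM13` (plan g76 `D76-K0V15/K0Skeleton13SepCoPHV15.lean` 7a515a944d49c6af; lane
«node O ∕ n21-c ∕ N10–N12 β letters»).  FILE Cʷ of the window edition (Summits side because dag-n07-e's bridge `variationalThm1RegSepCoP7M_of_prop8TopStep` lives here); A1ʷ∕A2ʷ∕Bʷ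
(`Node00.Record13NumericsOfThm1CCMW` ∕ `…LettersOfThm1CCMW` ∕ `…SepCoPInhabitedOfThm1CCMWGaugeR`), FILE C `…K0ROfStepTokensRCube` (`gauge9R_cube_of_prop8TopStep_of_prop6Member`,
`shrunkCeiling_pos`), dag-n07-e's FILE 29 (`b9Of`, `a0Of`, `b9Of_pos`, `a0Of_pos`) and N07's bridge CONSUMED BY NAME.  `--kind proof --supports stmt-QuantumFields-20541 --as helper`.
[15] = [Balaban1985Variational]; [6] = [Balaban1985RegularSpaces]; [III] = [Balaban1988Convergent]; [I] = [Balaban1987RG1]; [II] = [Balaban1989LargeFieldII]; [IV] = [Balaban1989LargeFieldI].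

LOCATED (this seat, g12) — WHY THE WINDOW MUST BE EXISTENTIAL.  V15 stub 3′ reads `BetaLowerH b ½ β ∧ BetaUpperH β′ ½ β`, `0 ≤ b`, `β′ ≤ 3`, for `β = betaOfRecord₁₃ F 2 θ₁₅ᶜᶜᴹ(3)`: the
sign and a uniform bound of [I]'s (1.20)–(1.22) on EVERY history in `]0, ½]^{k+1}` (couplings up to `g = 0.5`).  The numeral `½` is K0a's displayed default window, NOT print's: [I] Thm 1
p.255 ∕ §1 p.264 control `β_{k+1}` for `g_j ∈ [0, γ]`, «γ sufficiently small»; [II] p.355 ∕ (1.4) p.357 give positivity «for g_k small».  Every typed road in the tree has the shape `∃ γ₀ ≤ θ.γ`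
(K2's registered pair: `…N26AtRecord13BetaBoxOfDriftAtSlope.exists_betaBox_betaOfRecord₁₃_of_registeredPair`; the DAG leaf `DagBinding.betaPositive` is along-run in the world's own window).
So stub 3′ AS TYPED is beyond NODE O's perturbative reach, while its window weakening 3ʷ is exactly what those roads feed.  The witness-side cost of the weakening is nil: the window
enters the K0 provisos only through `Step.InInterval θ.γ` and the gauge-road letters need `γ ≤ ½` only (A2ʷ), and ON `]0, γ]` the β of record of the window edition `θ₁₅ᶜᶜᴹ(3; γ)` IS that
of `θ₁₅ᶜᶜᴹ(3)` (A2ʷ §5, `rfl`-level) — hence 3ʷ is stated on the SAME function `betaOfRecord₁₃ F 2 θ₁₅ᶜᶜᴹ(3)` as 3′, on a smaller box.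

WHAT THIS FILE PROVES (theorems only; 0 `def`).
§1 ★★★ `exists_k0H_of_prop8TopStep_of_prop6Member_of_betaBoxW (F) (hm : 4 ≤ F.m) (hB₃ : 2L² ≤ B₃) (ha₀) (ha₁) (h8 : Prop8RegSepTopStep …) (hB₁) (hc₁) (hP6 : B8.Prop6Printed … (zdCub …))
   (hγ0 : 0 < γ) (hγ : γ ≤ ½) (hε) (hε') (hb : 0 ≤ b) (hlow : BetaLowerH b γ (betaOfRecord₁₃ F 2 θ₁₅ᶜᶜᴹ(3; ε₀, ε₂₉; B₃, B₉·B₃, a₀, a₁′))) (hup) (hletter : β′·γ² ≤ ¾)` ⊢ the ⁷ body for `F` — FILE C's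
   ★★★ with the β-box read on `]0, γ]` instead of `]0, ½]`; ★★★ `exists_k0H_of_prop8TopStep_of_prop6Member_of_clausesW` ⊢ the same from the two HISTORY CLAUSES at `θ₁₅ᶜᶜᴹ(3; γ)` (the DAG
   leaf's along-run shape).
§2 THE V16 CANDIDATES, KERNEL-CHECKED (hypothesis form, bodies spelled out — no `def`): ★ `betaBoxW_of_betaBox_half` (a β-box on `]0, ½]` with `0 ≤ b`, `β′ ≤ 3` IS a windowed box:
   `γ := ½`, `3·¼ ≤ ¾`) — so V15's stub 3′ implies stub 3ʷ pointwise; ★★ `record13SepCoPHBody_of_stubsW (h1 : stub 1) (h2 : stub 2) (h3W : stub 3ʷ) (h4 : stub 4) : ∀ F, ⁷-body F`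
   (`= Record13SepCoPHInhabited` by `Iff.rfl`, plan's V15 `example`); ★★ `record13SepCoPHBody_of_stubsC` with the clause-form stub 3ᶜ; `stubC_of_stubW` (3ʷ ⇒ 3ᶜ, A2ʷ §6).
   IMPLICATIONS: 3′ ⇒ 3ʷ ⇒ 3ᶜ ⇒ (with stubs 1, 2, 4) K0⁷ — each weakening keeps the composition.
§3 THE LETTER-FREE FORM 3ˢ «SIGN ∧ UPPER BOUND ON SOME WINDOW»: `betaBoxW_of_sign_upper` (`BetaLowerH 0 γ₀ β ∧ BetaUpperH β′ γ₀ β`, `γ₀ > 0` ⟹ the 3ʷ-box on the shrunk window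
   `min γ₀ (min ½ (1+|β′|)⁻¹)` — the letter `β′·γ² ≤ ¾` and the constant `b` carry no content beyond the SIGN), `sign_upper_of_betaBoxW` (converse), `stubW_of_stubS` (3ˢ ⇒ 3ʷ),
   ★★ `record13SepCoPHBody_of_stubsS` — 3ˢ is NODE O's leaf at the K0 witness in print's vocabulary: the sign ([II] (1.4), unprinted) and «uniformly bounded» ([I] §1 p.264) on a
   window of its choosing; and BY THE TREE's NAME: `betaBoxW_of_betaSignH_of_upper` (`FlowStep.BetaSignH β` = T09.F weak form, + `∃ γ₁ > 0, ∃ β′, BetaUpperH β′ γ₁ β`),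
   `stubS_of_stubT` (3ᵀ ⇒ 3ˢ), ★★ `record13SepCoPHBody_of_stubsT` — 3ᵀ := «∃ ε₀ ε₂₉ > 0, BetaSignH (β₁₃(θ₁₅ᶜᶜᴹ(3))) ∧ ∃ γ₁ > 0, ∃ β′, BetaUpperH β′ γ₁ (β₁₃(θ₁₅ᶜᶜᴹ(3)))».
   CHAIN: 3′ ⇒ 3ʷ ⇔ 3ˢ ⇐ 3ᵀ, 3ʷ ⇒ 3ᶜ; each of 3ʷ∕3ˢ∕3ᵀ∕3ᶜ composes with stubs 1, 2, 4 to K0⁷'s body.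

HONEST FRAMING.  Compositions of tree theorems; CONDITIONAL on [15] Prop. 8's top step (N07), [6] Prop. 6 at the member (N05), the β-box ∕ history clauses (NODE O) and the signs — all
DISPLAYED hypotheses, never asserted; the `F.m ≤ 3` families are NOT covered by §1 (plan g75 LOCATED (δ), V15 stub 4); nothing of Bałaban asserted or discharged; K0⁷ NOT closed; V15 is the
skeleton OF RECORD — 3ʷ∕3ᶜ are CANDIDATES offered to the plan owner, not a re-registration; counts unmoved (typed 28∕28 · discharged 5∕27); one finite 𝕋⁴ programme at fixed ε — NOT
continuum ∕ OS ∕ mass gap ∕ Clay.  No `sorry`, `def`, `instance`, `notation`.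
-/

noncomputable section

open scoped Matrix.Norms.L2Operator

namespace Summit.QuantumFields.YangMills.Theorems.K0WindowOfStepTokensRCube

open Literature.MathematicalPhysics.QuantumFieldTheory.Balaban1983to89
open Literature.MathematicalPhysics.QuantumFieldTheory.Balaban1983to89.T4Continuum
open Literature.MathematicalPhysics.QuantumFieldTheory.Balaban1983to89.Node00
open Literature.MathematicalPhysics.QuantumFieldTheory.Balaban1983to89.FlowStep
open Summit.QuantumFields.YangMills.BalabanUVNodes.N07Thm1Top7FromProp8 (variationalThm1RegSepCoP7M_of_prop8TopStep)
open Summit.QuantumFields.YangMills.Theorems.K0ROfStepTokensRCube (shrunkCeiling_pos gauge9R_cube_of_prop8TopStep_of_prop6Member)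

/-! ## §1. The ⁷ K0 body for `F` (`4 ≤ F.m`) from the two printed inputs, the signs, and the WINDOWED β-box ∕ the history clauses -/

section Cube

variable (F : T4Family)

/-- **★★★ THE ⁷ K0 BODY FOR `F` (`4 ≤ F.m`) AT `N = 2` FROM [15] PROP. 8's TOP STEP, [6] PROP. 6 AT NODE 00's MEMBER, THE SIGNS, AND THE β-BOX OF `betaOfRecord₁₃ F 2 θ₁₅ᶜᶜᴹ(3)` ON A
WINDOW `]0, γ] ⊆ ]0, ½]`** (`0 ≤ b`, `β′·γ² ≤ ¾`) — FILE C's `exists_k0H_of_prop8TopStep_of_prop6Member_of_betaBox` with the box `]0, ½]`, `β′ ≤ 3` weakened to ANY such window: Prop. 8 ⇒ (8)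
(N07's bridge) and, with Prop. 6, the R (9)-step at `(L³, (44+3L)L)` (FILE C); Bʷ's `_of_betaBox_half_cube` at the window edition `θ₁₅ᶜᶜᴹ(3; γ)`, whose β on `]0, γ]` IS `θ₁₅ᶜᶜᴹ(3)`'s
(A2ʷ §5).  CONDITIONAL on every displayed hypothesis; K0⁷ NOT closed here. [cite: Balaban1985Variational, (6)–(7) p.278, Thm 1 (8)–(9) p.279, (144)–(152) pp.300–301, Prop. 8 p.304; Balaban1985RegularSpaces, (1.3)–(1.9) p.77, Prop. 6 p.99; Balaban1988Convergent, Thm 1 p.262, (2.4)–(2.8) pp.255–256, (2.12)–(2.13) pp.256–257, (2.21) p.258, (3.16)–(3.23) pp.268–270; Balaban1987RG1, Thm 1 p.259, (0.1) p.251, (0.20) p.256, (1.20)–(1.22) p.264; Balaban1989LargeFieldII, (1.4) p.357; Balaban1989LargeFieldI, (0.2)–(0.4) p.176] -/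
theorem exists_k0H_of_prop8TopStep_of_prop6Member_of_betaBoxW (hm : 4 ≤ F.m) {B₃ a₀ a₁ B₁ c₁ : ℝ} (hB₃ : 2 * (F.L : ℝ) ^ 2 ≤ B₃) (ha₀ : 0 < a₀) (ha₁ : 0 < a₁)
    (h8 : Prop8RegSepTopStep F 2 (fun ν K Ω => suppDomOfRecord F ν K Ω) B₃ a₀ a₁) (hB₁ : 0 ≤ B₁) (hc₁ : 0 < c₁)
    (hP6 : letI : CStarAlgebra (MatA 2) := {}; B8.Prop6Printed 4 (F.L : ℝ) B₁ c₁ (fun i : B8LeafModelZd.ZdIdx 4 F.L => zdCub (MatA 2) F.L i))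
    {γ ε₀ ε₂₉ b β' : ℝ} (hγ0 : 0 < γ) (hγ : γ ≤ 1 / 2) (hε : 0 < ε₀) (hε' : 0 < ε₂₉) (hb : 0 ≤ b)
    (hlow : BetaLowerH b γ (betaOfRecord₁₃ F 2
      (theta13OfThm1CCM F 2 3 ε₀ ε₂₉ B₃ (b9Of F (F.L ^ 3) B₁ * B₃) a₀ (min a₁ (a0Of F 2 (F.L ^ 3) B₁ c₁ / B₃)))))
    (hup : BetaUpperH β' γ (betaOfRecord₁₃ F 2
      (theta13OfThm1CCM F 2 3 ε₀ ε₂₉ B₃ (b9Of F (F.L ^ 3) B₁ * B₃) a₀ (min a₁ (a0Of F 2 (F.L ^ 3) B₁ c₁ / B₃))))) (hletter : β' * γ ^ 2 ≤ 3 / 4) :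
    ∃ θ : Stage13HParams F 2, θ.Provisos₁₃SepCoPH F 2 ∧ (θ.ZhUnity F 2 ∧ θ.SlotsNondegenerate₁₃ F 2) ∧ θ.Admissible F 2 := by
  have hL : (0 : ℝ) < (F.L : ℝ) := by exact_mod_cast lt_trans Nat.zero_lt_one F.hL.2
  have hBpos : (0 : ℝ) < B₃ := lt_of_lt_of_le (mul_pos two_pos (pow_pos hL 2)) hB₃
  have hB9 : 0 ≤ b9Of F (F.L ^ 3) B₁ * B₃ := mul_nonneg (b9Of_pos (F := F) (F.L ^ 3) hB₁).le hBpos.le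
  exact exists_k0SepCoPH_thm1CCMW_of_gauge9TopStepR_of_betaBox_half_cube F hm hγ0 hγ hε hε' hBpos.le hB9 ha₀ (shrunkCeiling_pos F (F.L ^ 3) hBpos hB₁ hc₁ ha₁)
    (variationalThm1RegSepCoP7M_of_prop8TopStep hBpos (h8.of_le le_rfl (min_le_left _ _))) (gauge9R_cube_of_prop8TopStep_of_prop6Member F hBpos h8 hB₁ hc₁ hP6)
    hb hlow hup hletter

/-- **★★★ THE SAME ⁷ K0 BODY FROM THE TWO HISTORY CLAUSES AT THE WINDOW EDITION `θ₁₅ᶜᶜᴹ(3; γ)`** (monotone windowed histories and the reverse comparability of consecutive thresholds,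
along every `γ`-windowed run — the DAG leaf `betaPositive`'s along-run shape; A2ʷ §6 derives them from any windowed β-box).  CONDITIONAL; K0⁷ NOT closed here.
[cite: Balaban1985Variational, Thm 1 (8)–(9) p.279, (144)–(152) pp.300–301, Prop. 8 p.304; Balaban1985RegularSpaces, (1.3)–(1.9) p.77, Prop. 6 p.99; Balaban1988Convergent, Thm 1 p.262, (2.4)–(2.8) pp.255–256, (2.21) p.258, (3.16)–(3.23) pp.268–270; Balaban1987RG1, Thm 1 p.259, (0.20) p.256; Balaban1989LargeFieldI, (0.2)–(0.4) p.176] -/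
theorem exists_k0H_of_prop8TopStep_of_prop6Member_of_clausesW (hm : 4 ≤ F.m) {B₃ a₀ a₁ B₁ c₁ : ℝ} (hB₃ : 2 * (F.L : ℝ) ^ 2 ≤ B₃) (ha₀ : 0 < a₀) (ha₁ : 0 < a₁)
    (h8 : Prop8RegSepTopStep F 2 (fun ν K Ω => suppDomOfRecord F ν K Ω) B₃ a₀ a₁) (hB₁ : 0 ≤ B₁) (hc₁ : 0 < c₁)
    (hP6 : letI : CStarAlgebra (MatA 2) := {}; B8.Prop6Printed 4 (F.L : ℝ) B₁ c₁ (fun i : B8LeafModelZd.ZdIdx 4 F.L => zdCub (MatA 2) F.L i))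
    {γ ε₀ ε₂₉ : ℝ} (hγ0 : 0 < γ) (hγ : γ ≤ 1 / 2) (hε : 0 < ε₀) (hε' : 0 < ε₂₉)
    (hmono : ∀ (p : B12.RunParams) (n : ℕ), n ≤ p.K →
      Step.InInterval (theta13OfThm1CCMW F 2 3 γ ε₀ ε₂₉ B₃ (b9Of F (F.L ^ 3) B₁ * B₃) a₀ (min a₁ (a0Of F 2 (F.L ^ 3) B₁ c₁ / B₃))).γ n
        (gOfRecord₁₃ F 2 (theta13OfThm1CCMW F 2 3 γ ε₀ ε₂₉ B₃ (b9Of F (F.L ^ 3) B₁ * B₃) a₀ (min a₁ (a0Of F 2 (F.L ^ 3) B₁ c₁ / B₃))) p) → ∀ m, m < n →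
      gOfRecord₁₃ F 2 (theta13OfThm1CCMW F 2 3 γ ε₀ ε₂₉ B₃ (b9Of F (F.L ^ 3) B₁ * B₃) a₀ (min a₁ (a0Of F 2 (F.L ^ 3) B₁ c₁ / B₃))) p m ≤
        gOfRecord₁₃ F 2 (theta13OfThm1CCMW F 2 3 γ ε₀ ε₂₉ B₃ (b9Of F (F.L ^ 3) B₁ * B₃) a₀ (min a₁ (a0Of F 2 (F.L ^ 3) B₁ c₁ / B₃))) p (m + 1))
    (hcompRev : ∀ (p : B12.RunParams) (n : ℕ), n ≤ p.K →
      Step.InInterval (theta13OfThm1CCMW F 2 3 γ ε₀ ε₂₉ B₃ (b9Of F (F.L ^ 3) B₁ * B₃) a₀ (min a₁ (a0Of F 2 (F.L ^ 3) B₁ c₁ / B₃))).γ n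
        (gOfRecord₁₃ F 2 (theta13OfThm1CCMW F 2 3 γ ε₀ ε₂₉ B₃ (b9Of F (F.L ^ 3) B₁ * B₃) a₀ (min a₁ (a0Of F 2 (F.L ^ 3) B₁ c₁ / B₃))) p) → ∀ m, m < n →
      (theta13OfThm1CCMW F 2 3 γ ε₀ ε₂₉ B₃ (b9Of F (F.L ^ 3) B₁ * B₃) a₀ (min a₁ (a0Of F 2 (F.L ^ 3) B₁ c₁ / B₃))).s2.cR *
          epsOfRecord (theta13OfThm1CCMW F 2 3 γ ε₀ ε₂₉ B₃ (b9Of F (F.L ^ 3) B₁ * B₃) a₀ (min a₁ (a0Of F 2 (F.L ^ 3) B₁ c₁ / B₃))).ν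
            (gOfRecord₁₃ F 2 (theta13OfThm1CCMW F 2 3 γ ε₀ ε₂₉ B₃ (b9Of F (F.L ^ 3) B₁ * B₃) a₀ (min a₁ (a0Of F 2 (F.L ^ 3) B₁ c₁ / B₃))) p) (m + 1) ≤
        2 * ((theta13OfThm1CCMW F 2 3 γ ε₀ ε₂₉ B₃ (b9Of F (F.L ^ 3) B₁ * B₃) a₀ (min a₁ (a0Of F 2 (F.L ^ 3) B₁ c₁ / B₃))).s2.cR *
          epsOfRecord (theta13OfThm1CCMW F 2 3 γ ε₀ ε₂₉ B₃ (b9Of F (F.L ^ 3) B₁ * B₃) a₀ (min a₁ (a0Of F 2 (F.L ^ 3) B₁ c₁ / B₃))).ν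
            (gOfRecord₁₃ F 2 (theta13OfThm1CCMW F 2 3 γ ε₀ ε₂₉ B₃ (b9Of F (F.L ^ 3) B₁ * B₃) a₀ (min a₁ (a0Of F 2 (F.L ^ 3) B₁ c₁ / B₃))) p) m)) :
    ∃ θ : Stage13HParams F 2, θ.Provisos₁₃SepCoPH F 2 ∧ (θ.ZhUnity F 2 ∧ θ.SlotsNondegenerate₁₃ F 2) ∧ θ.Admissible F 2 := by
  have hL : (0 : ℝ) < (F.L : ℝ) := by exact_mod_cast lt_trans Nat.zero_lt_one F.hL.2
  have hBpos : (0 : ℝ) < B₃ := lt_of_lt_of_le (mul_pos two_pos (pow_pos hL 2)) hB₃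
  have hB9 : 0 ≤ b9Of F (F.L ^ 3) B₁ * B₃ := mul_nonneg (b9Of_pos (F := F) (F.L ^ 3) hB₁).le hBpos.le
  exact exists_k0SepCoPH_thm1CCMW_of_gauge9TopStepR_of_clauses_cube F hm hγ0 hγ hε hε' hBpos.le hB9 ha₀ (shrunkCeiling_pos F (F.L ^ 3) hBpos hB₁ hc₁ ha₁)
    (variationalThm1RegSepCoP7M_of_prop8TopStep hBpos (h8.of_le le_rfl (min_le_left _ _))) (gauge9R_cube_of_prop8TopStep_of_prop6Member F hBpos h8 hB₁ hc₁ hP6)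
    hmono hcompRev

end Cube

/-! ## §2. The V16 candidates: `stub 3′ ⇒ stub 3ʷ ⇒ stub 3ᶜ`, and the compositions «stubs 1, 2, 3ʷ (resp. 3ᶜ), 4 ⇒ ∀ F, K0⁷-body F» -/

section Candidates

/-- **★ A β-BOX ON `]0, ½]` WITH `0 ≤ b`, `β′ ≤ 3` IS A WINDOWED β-BOX** (`γ := ½`: `β′·(½)² ≤ ¾`) — V15's stub 3′ implies the window weakening 3ʷ pointwise, for ANY family of β-functions.
[cite: Balaban1987RG1, §1 p.264 (bookkeeping)] -/
theorem betaBoxW_of_betaBox_half {β : HBeta} {b β' : ℝ} (hb : 0 ≤ b) (hlow : BetaLowerH b (1 / 2) β) (hup : BetaUpperH β' (1 / 2) β) (hβ' : β' ≤ 3) :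
    ∃ γ b₁ β₁ : ℝ, 0 < γ ∧ γ ≤ 1 / 2 ∧ 0 ≤ b₁ ∧ β₁ * γ ^ 2 ≤ 3 / 4 ∧ BetaLowerH b₁ γ β ∧ BetaUpperH β₁ γ β :=
  ⟨1 / 2, b, β', by norm_num, le_rfl, hb, by nlinarith, hlow, hup⟩

/-- **V15's STUB 3′ BODY AT `F` IMPLIES THE WINDOW STUB 3ʷ BODY AT `F`** (texts spelled out; `γ := ½`). [cite: Balaban1987RG1, Thm 1 p.259, §1 p.264; Balaban1989LargeFieldII, (1.4) p.357 (bookkeeping)] -/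
theorem stubW_of_stub15 (F : T4Family)
    (h3 : ∀ B₃ B₃' a₀ a₁ : ℝ, 2 * (F.L : ℝ) ^ 2 ≤ B₃ → 0 < B₃' → 0 < a₀ → 0 < a₁ →
      VariationalThm1RegSepCoP7M F 2 B₃ a₀ a₁ →
      Gauge9RegSepTopStepR F 2 (fun ν K Ω => suppDomOfRecord F ν K Ω) (F.L ^ 3) ((11 * 4 + 3 * F.L) * F.L) B₃ B₃' a₀ a₁ →
      ∃ ε₀ ε₂₉ b β' : ℝ, 0 < ε₀ ∧ 0 < ε₂₉ ∧ 0 ≤ b ∧ β' ≤ 3 ∧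
        BetaLowerH b (1 / 2) (betaOfRecord₁₃ F 2 (theta13OfThm1CCM F 2 3 ε₀ ε₂₉ B₃ B₃' a₀ a₁)) ∧
        BetaUpperH β' (1 / 2) (betaOfRecord₁₃ F 2 (theta13OfThm1CCM F 2 3 ε₀ ε₂₉ B₃ B₃' a₀ a₁))) :
    ∀ B₃ B₃' a₀ a₁ : ℝ, 2 * (F.L : ℝ) ^ 2 ≤ B₃ → 0 < B₃' → 0 < a₀ → 0 < a₁ →
      VariationalThm1RegSepCoP7M F 2 B₃ a₀ a₁ →
      Gauge9RegSepTopStepR F 2 (fun ν K Ω => suppDomOfRecord F ν K Ω) (F.L ^ 3) ((11 * 4 + 3 * F.L) * F.L) B₃ B₃' a₀ a₁ →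
      ∃ γ ε₀ ε₂₉ b β' : ℝ, 0 < γ ∧ γ ≤ 1 / 2 ∧ 0 < ε₀ ∧ 0 < ε₂₉ ∧ 0 ≤ b ∧ β' * γ ^ 2 ≤ 3 / 4 ∧
        BetaLowerH b γ (betaOfRecord₁₃ F 2 (theta13OfThm1CCM F 2 3 ε₀ ε₂₉ B₃ B₃' a₀ a₁)) ∧
        BetaUpperH β' γ (betaOfRecord₁₃ F 2 (theta13OfThm1CCM F 2 3 ε₀ ε₂₉ B₃ B₃' a₀ a₁)) := by
  intro B₃ B₃' a₀ a₁ hB₃ hB₃' ha₀ ha₁ h15 h9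
  obtain ⟨ε₀, ε₂₉, b, β', hε, hε', hb, hβ', hlow, hup⟩ := h3 B₃ B₃' a₀ a₁ hB₃ hB₃' ha₀ ha₁ h15 h9
  exact ⟨1 / 2, ε₀, ε₂₉, b, β', by norm_num, le_rfl, hε, hε', hb, by nlinarith, hlow, hup⟩

/-- **THE WINDOW STUB 3ʷ BODY AT `F` IMPLIES THE CLAUSE STUB 3ᶜ BODY AT `F`** (A2ʷ §6: the two history clauses at `θ₁₅ᶜᶜᴹ(3; γ)` from the β-box of `θ₁₅ᶜᶜᴹ(3)` on `]0, γ]`).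
[cite: Balaban1988Convergent, (2.6)–(2.8) pp.255–256; Balaban1987RG1, (0.20) p.256, (1.20)–(1.22) p.264 (bookkeeping)] -/
theorem stubC_of_stubW (F : T4Family)
    (h3W : ∀ B₃ B₃' a₀ a₁ : ℝ, 2 * (F.L : ℝ) ^ 2 ≤ B₃ → 0 < B₃' → 0 < a₀ → 0 < a₁ →
      VariationalThm1RegSepCoP7M F 2 B₃ a₀ a₁ →
      Gauge9RegSepTopStepR F 2 (fun ν K Ω => suppDomOfRecord F ν K Ω) (F.L ^ 3) ((11 * 4 + 3 * F.L) * F.L) B₃ B₃' a₀ a₁ →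
      ∃ γ ε₀ ε₂₉ b β' : ℝ, 0 < γ ∧ γ ≤ 1 / 2 ∧ 0 < ε₀ ∧ 0 < ε₂₉ ∧ 0 ≤ b ∧ β' * γ ^ 2 ≤ 3 / 4 ∧
        BetaLowerH b γ (betaOfRecord₁₃ F 2 (theta13OfThm1CCM F 2 3 ε₀ ε₂₉ B₃ B₃' a₀ a₁)) ∧
        BetaUpperH β' γ (betaOfRecord₁₃ F 2 (theta13OfThm1CCM F 2 3 ε₀ ε₂₉ B₃ B₃' a₀ a₁))) :
    ∀ B₃ B₃' a₀ a₁ : ℝ, 2 * (F.L : ℝ) ^ 2 ≤ B₃ → 0 < B₃' → 0 < a₀ → 0 < a₁ →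
      VariationalThm1RegSepCoP7M F 2 B₃ a₀ a₁ →
      Gauge9RegSepTopStepR F 2 (fun ν K Ω => suppDomOfRecord F ν K Ω) (F.L ^ 3) ((11 * 4 + 3 * F.L) * F.L) B₃ B₃' a₀ a₁ →
      ∃ γ ε₀ ε₂₉ : ℝ, 0 < γ ∧ γ ≤ 1 / 2 ∧ 0 < ε₀ ∧ 0 < ε₂₉ ∧
        (∀ (p : B12.RunParams) (n : ℕ), n ≤ p.K → Step.InInterval (theta13OfThm1CCMW F 2 3 γ ε₀ ε₂₉ B₃ B₃' a₀ a₁).γ n (gOfRecord₁₃ F 2 (theta13OfThm1CCMW F 2 3 γ ε₀ ε₂₉ B₃ B₃' a₀ a₁) p) → ∀ m, m < n →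
          gOfRecord₁₃ F 2 (theta13OfThm1CCMW F 2 3 γ ε₀ ε₂₉ B₃ B₃' a₀ a₁) p m ≤ gOfRecord₁₃ F 2 (theta13OfThm1CCMW F 2 3 γ ε₀ ε₂₉ B₃ B₃' a₀ a₁) p (m + 1)) ∧
        (∀ (p : B12.RunParams) (n : ℕ), n ≤ p.K → Step.InInterval (theta13OfThm1CCMW F 2 3 γ ε₀ ε₂₉ B₃ B₃' a₀ a₁).γ n (gOfRecord₁₃ F 2 (theta13OfThm1CCMW F 2 3 γ ε₀ ε₂₉ B₃ B₃' a₀ a₁) p) → ∀ m, m < n →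
          (theta13OfThm1CCMW F 2 3 γ ε₀ ε₂₉ B₃ B₃' a₀ a₁).s2.cR * epsOfRecord (theta13OfThm1CCMW F 2 3 γ ε₀ ε₂₉ B₃ B₃' a₀ a₁).ν (gOfRecord₁₃ F 2 (theta13OfThm1CCMW F 2 3 γ ε₀ ε₂₉ B₃ B₃' a₀ a₁) p) (m + 1) ≤
            2 * ((theta13OfThm1CCMW F 2 3 γ ε₀ ε₂₉ B₃ B₃' a₀ a₁).s2.cR * epsOfRecord (theta13OfThm1CCMW F 2 3 γ ε₀ ε₂₉ B₃ B₃' a₀ a₁).ν (gOfRecord₁₃ F 2 (theta13OfThm1CCMW F 2 3 γ ε₀ ε₂₉ B₃ B₃' a₀ a₁) p) m)) := by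
  intro B₃ B₃' a₀ a₁ hB₃ hB₃' ha₀ ha₁ h15 h9
  obtain ⟨γ, ε₀, ε₂₉, b, β', hγ0, hγ, hε, hε', hb, hletter, hlow, hup⟩ := h3W B₃ B₃' a₀ a₁ hB₃ hB₃' ha₀ ha₁ h15 h9
  have hL : (0 : ℝ) < (F.L : ℝ) := by exact_mod_cast lt_trans Nat.zero_lt_one F.hL.2
  have hB : (0 : ℝ) ≤ B₃ := (mul_pos two_pos (pow_pos hL 2)).le.trans hB₃
  exact ⟨γ, ε₀, ε₂₉, hγ0, hγ, hε, hε', hmono_theta13OfThm1CCMW_of_betaLowerH_half hγ hb hlow,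
    hcompRev_theta13OfThm1CCMW_of_betaBox_half hγ hB hB₃'.le ha₀.le ha₁.le hb hlow hup hletter⟩

/-- **★★ THE V16 CANDIDATE, CLAUSE FORM — K0⁷'s BODY AT EVERY FAMILY from stub 1 ([15] Prop. 8's top step), stub 2 ([6] Prop. 6 at the member), the CLAUSE STUB 3ᶜ (for every guarded
constants tuple, SOME window `γ ∈ ]0, ½]` and thresholds at which the two history clauses hold at `θ₁₅ᶜᶜᴹ(3; γ)`) and stub 4 (the declared small-torus residual)** — plan g76's V15
composition with §1's clause-form closer on print's range `4 ≤ F.m`.  Hypothesis form, no `sorry`; the conclusion is `Record13SepCoPHInhabited` unfolded (V15's `example`, `Iff.rfl`).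
[cite: Balaban1985Variational, Thm 1 (8)–(9) p.279, (152) p.301, Prop. 8 p.304; Balaban1985RegularSpaces, Prop. 6 p.99; Balaban1988Convergent, Thm 1 p.262, (2.6)–(2.8) pp.255–256, (3.16)–(3.23) pp.268–270; Balaban1987RG1, Thm 1 p.259, (0.20) p.256; Balaban1989LargeFieldI, (0.2)–(0.4) p.176] -/
theorem record13SepCoPHBody_of_stubsC
    (h1 : ∀ F : T4Family, ∃ B₃ a₀ a₁ : ℝ, 2 * (F.L : ℝ) ^ 2 ≤ B₃ ∧ 0 < a₀ ∧ 0 < a₁ ∧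
      Prop8RegSepTopStep F 2 (fun ν K Ω => suppDomOfRecord F ν K Ω) B₃ a₀ a₁)
    (h2 : ∀ F : T4Family, ∃ B₁ c₁ : ℝ, 0 ≤ B₁ ∧ 0 < c₁ ∧
      (letI : CStarAlgebra (MatA 2) := {}; B8.Prop6Printed 4 (F.L : ℝ) B₁ c₁ (fun i : B8LeafModelZd.ZdIdx 4 F.L => zdCub (MatA 2) F.L i)))
    (h3C : ∀ (F : T4Family) (B₃ B₃' a₀ a₁ : ℝ), 2 * (F.L : ℝ) ^ 2 ≤ B₃ → 0 < B₃' → 0 < a₀ → 0 < a₁ →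
      VariationalThm1RegSepCoP7M F 2 B₃ a₀ a₁ →
      Gauge9RegSepTopStepR F 2 (fun ν K Ω => suppDomOfRecord F ν K Ω) (F.L ^ 3) ((11 * 4 + 3 * F.L) * F.L) B₃ B₃' a₀ a₁ →
      ∃ γ ε₀ ε₂₉ : ℝ, 0 < γ ∧ γ ≤ 1 / 2 ∧ 0 < ε₀ ∧ 0 < ε₂₉ ∧
        (∀ (p : B12.RunParams) (n : ℕ), n ≤ p.K → Step.InInterval (theta13OfThm1CCMW F 2 3 γ ε₀ ε₂₉ B₃ B₃' a₀ a₁).γ n (gOfRecord₁₃ F 2 (theta13OfThm1CCMW F 2 3 γ ε₀ ε₂₉ B₃ B₃' a₀ a₁) p) → ∀ m, m < n →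
          gOfRecord₁₃ F 2 (theta13OfThm1CCMW F 2 3 γ ε₀ ε₂₉ B₃ B₃' a₀ a₁) p m ≤ gOfRecord₁₃ F 2 (theta13OfThm1CCMW F 2 3 γ ε₀ ε₂₉ B₃ B₃' a₀ a₁) p (m + 1)) ∧
        (∀ (p : B12.RunParams) (n : ℕ), n ≤ p.K → Step.InInterval (theta13OfThm1CCMW F 2 3 γ ε₀ ε₂₉ B₃ B₃' a₀ a₁).γ n (gOfRecord₁₃ F 2 (theta13OfThm1CCMW F 2 3 γ ε₀ ε₂₉ B₃ B₃' a₀ a₁) p) → ∀ m, m < n →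
          (theta13OfThm1CCMW F 2 3 γ ε₀ ε₂₉ B₃ B₃' a₀ a₁).s2.cR * epsOfRecord (theta13OfThm1CCMW F 2 3 γ ε₀ ε₂₉ B₃ B₃' a₀ a₁).ν (gOfRecord₁₃ F 2 (theta13OfThm1CCMW F 2 3 γ ε₀ ε₂₉ B₃ B₃' a₀ a₁) p) (m + 1) ≤
            2 * ((theta13OfThm1CCMW F 2 3 γ ε₀ ε₂₉ B₃ B₃' a₀ a₁).s2.cR * epsOfRecord (theta13OfThm1CCMW F 2 3 γ ε₀ ε₂₉ B₃ B₃' a₀ a₁).ν (gOfRecord₁₃ F 2 (theta13OfThm1CCMW F 2 3 γ ε₀ ε₂₉ B₃ B₃' a₀ a₁) p) m)))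
    (h4 : ∀ F : T4Family, F.m ≤ 3 → ∃ θ : Stage13HParams F 2, θ.Provisos₁₃SepCoPH F 2 ∧ (θ.ZhUnity F 2 ∧ θ.SlotsNondegenerate₁₃ F 2) ∧ θ.Admissible F 2) :
    ∀ F : T4Family, ∃ θ : Stage13HParams F 2, θ.Provisos₁₃SepCoPH F 2 ∧ (θ.ZhUnity F 2 ∧ θ.SlotsNondegenerate₁₃ F 2) ∧ θ.Admissible F 2 := by
  intro F
  by_cases hm : 4 ≤ F.m
  · obtain ⟨B₃, a₀, a₁, hB₃, ha₀, ha₁, h8⟩ := h1 F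
    have hL : (0 : ℝ) < (F.L : ℝ) := by exact_mod_cast lt_trans Nat.zero_lt_one F.hL.2
    have hBpos : (0 : ℝ) < B₃ := lt_of_lt_of_le (mul_pos two_pos (pow_pos hL 2)) hB₃
    obtain ⟨B₁, c₁, hB₁, hc₁, hP6⟩ := h2 F
    have ha₁' : 0 < min a₁ (a0Of F 2 (F.L ^ 3) B₁ c₁ / B₃) := shrunkCeiling_pos F (F.L ^ 3) hBpos hB₁ hc₁ ha₁
    have hB₉ : 0 < b9Of F (F.L ^ 3) B₁ * B₃ := mul_pos (b9Of_pos (F := F) (F.L ^ 3) hB₁) hBpos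
    obtain ⟨γ, ε₀, ε₂₉, hγ0, hγ, hε, hε', hmono, hcompRev⟩ :=
      h3C F B₃ (b9Of F (F.L ^ 3) B₁ * B₃) a₀ (min a₁ (a0Of F 2 (F.L ^ 3) B₁ c₁ / B₃)) hB₃ hB₉ ha₀ ha₁'
        (variationalThm1RegSepCoP7M_of_prop8TopStep hBpos (h8.of_le le_rfl (min_le_left _ _))) (gauge9R_cube_of_prop8TopStep_of_prop6Member F hBpos h8 hB₁ hc₁ hP6)
    exact exists_k0H_of_prop8TopStep_of_prop6Member_of_clausesW F hm hB₃ ha₀ ha₁ h8 hB₁ hc₁ hP6 hγ0 hγ hε hε' hmono hcompRev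
  · exact h4 F (by omega)

/-- **★★ THE V16 CANDIDATE, WINDOW-BOX FORM — K0⁷'s BODY AT EVERY FAMILY from stub 1, stub 2, THE WINDOW STUB 3ʷ (for every guarded constants tuple, SOME window `γ ∈ ]0, ½]`, thresholds
`ε₀, ε₂₉ > 0` and box constants `0 ≤ b`, `β′·γ² ≤ ¾` put `betaOfRecord₁₃ F 2 θ₁₅ᶜᶜᴹ(3)` in the box on `]0, γ]`) and stub 4** — V15's composition with 3′ weakened to 3ʷ (3ʷ ⇒ 3ᶜ ∘ the clause form).
Hypothesis form, no `sorry`. [cite: Balaban1985Variational, Thm 1 (8)–(9) p.279, (152) p.301, Prop. 8 p.304; Balaban1985RegularSpaces, Prop. 6 p.99; Balaban1988Convergent, Thm 1 p.262, (2.6)–(2.8) pp.255–256, (3.16)–(3.23) pp.268–270; Balaban1987RG1, Thm 1 p.259, (0.20) p.256, (1.20)–(1.22) p.264, §1 p.264; Balaban1989LargeFieldII, (1.4) p.357; Balaban1989LargeFieldI, (0.2)–(0.4) p.176] -/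
theorem record13SepCoPHBody_of_stubsW
    (h1 : ∀ F : T4Family, ∃ B₃ a₀ a₁ : ℝ, 2 * (F.L : ℝ) ^ 2 ≤ B₃ ∧ 0 < a₀ ∧ 0 < a₁ ∧
      Prop8RegSepTopStep F 2 (fun ν K Ω => suppDomOfRecord F ν K Ω) B₃ a₀ a₁)
    (h2 : ∀ F : T4Family, ∃ B₁ c₁ : ℝ, 0 ≤ B₁ ∧ 0 < c₁ ∧
      (letI : CStarAlgebra (MatA 2) := {}; B8.Prop6Printed 4 (F.L : ℝ) B₁ c₁ (fun i : B8LeafModelZd.ZdIdx 4 F.L => zdCub (MatA 2) F.L i)))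
    (h3W : ∀ (F : T4Family) (B₃ B₃' a₀ a₁ : ℝ), 2 * (F.L : ℝ) ^ 2 ≤ B₃ → 0 < B₃' → 0 < a₀ → 0 < a₁ →
      VariationalThm1RegSepCoP7M F 2 B₃ a₀ a₁ →
      Gauge9RegSepTopStepR F 2 (fun ν K Ω => suppDomOfRecord F ν K Ω) (F.L ^ 3) ((11 * 4 + 3 * F.L) * F.L) B₃ B₃' a₀ a₁ →
      ∃ γ ε₀ ε₂₉ b β' : ℝ, 0 < γ ∧ γ ≤ 1 / 2 ∧ 0 < ε₀ ∧ 0 < ε₂₉ ∧ 0 ≤ b ∧ β' * γ ^ 2 ≤ 3 / 4 ∧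
        BetaLowerH b γ (betaOfRecord₁₃ F 2 (theta13OfThm1CCM F 2 3 ε₀ ε₂₉ B₃ B₃' a₀ a₁)) ∧
        BetaUpperH β' γ (betaOfRecord₁₃ F 2 (theta13OfThm1CCM F 2 3 ε₀ ε₂₉ B₃ B₃' a₀ a₁)))
    (h4 : ∀ F : T4Family, F.m ≤ 3 → ∃ θ : Stage13HParams F 2, θ.Provisos₁₃SepCoPH F 2 ∧ (θ.ZhUnity F 2 ∧ θ.SlotsNondegenerate₁₃ F 2) ∧ θ.Admissible F 2) :
    ∀ F : T4Family, ∃ θ : Stage13HParams F 2, θ.Provisos₁₃SepCoPH F 2 ∧ (θ.ZhUnity F 2 ∧ θ.SlotsNondegenerate₁₃ F 2) ∧ θ.Admissible F 2 :=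
  record13SepCoPHBody_of_stubsC h1 h2 (fun F => stubC_of_stubW F (h3W F)) h4

/-- **V15 RECOVERED**: with V15's stub 3′ text in place of 3ʷ the same body follows (3′ ⇒ 3ʷ, `stubW_of_stub15`) — so 3ʷ is a pure WEAKENING of the registered stub that keeps the composition.
[cite: Balaban1987RG1, Thm 1 p.259, §1 p.264 (bookkeeping)] -/
theorem record13SepCoPHBody_of_stubs15
    (h1 : ∀ F : T4Family, ∃ B₃ a₀ a₁ : ℝ, 2 * (F.L : ℝ) ^ 2 ≤ B₃ ∧ 0 < a₀ ∧ 0 < a₁ ∧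
      Prop8RegSepTopStep F 2 (fun ν K Ω => suppDomOfRecord F ν K Ω) B₃ a₀ a₁)
    (h2 : ∀ F : T4Family, ∃ B₁ c₁ : ℝ, 0 ≤ B₁ ∧ 0 < c₁ ∧
      (letI : CStarAlgebra (MatA 2) := {}; B8.Prop6Printed 4 (F.L : ℝ) B₁ c₁ (fun i : B8LeafModelZd.ZdIdx 4 F.L => zdCub (MatA 2) F.L i)))
    (h3 : ∀ (F : T4Family) (B₃ B₃' a₀ a₁ : ℝ), 2 * (F.L : ℝ) ^ 2 ≤ B₃ → 0 < B₃' → 0 < a₀ → 0 < a₁ →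
      VariationalThm1RegSepCoP7M F 2 B₃ a₀ a₁ →
      Gauge9RegSepTopStepR F 2 (fun ν K Ω => suppDomOfRecord F ν K Ω) (F.L ^ 3) ((11 * 4 + 3 * F.L) * F.L) B₃ B₃' a₀ a₁ →
      ∃ ε₀ ε₂₉ b β' : ℝ, 0 < ε₀ ∧ 0 < ε₂₉ ∧ 0 ≤ b ∧ β' ≤ 3 ∧
        BetaLowerH b (1 / 2) (betaOfRecord₁₃ F 2 (theta13OfThm1CCM F 2 3 ε₀ ε₂₉ B₃ B₃' a₀ a₁)) ∧
        BetaUpperH β' (1 / 2) (betaOfRecord₁₃ F 2 (theta13OfThm1CCM F 2 3 ε₀ ε₂₉ B₃ B₃' a₀ a₁)))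
    (h4 : ∀ F : T4Family, F.m ≤ 3 → ∃ θ : Stage13HParams F 2, θ.Provisos₁₃SepCoPH F 2 ∧ (θ.ZhUnity F 2 ∧ θ.SlotsNondegenerate₁₃ F 2) ∧ θ.Admissible F 2) :
    ∀ F : T4Family, ∃ θ : Stage13HParams F 2, θ.Provisos₁₃SepCoPH F 2 ∧ (θ.ZhUnity F 2 ∧ θ.SlotsNondegenerate₁₃ F 2) ∧ θ.Admissible F 2 :=
  record13SepCoPHBody_of_stubsW h1 h2 (fun F => stubW_of_stub15 F (h3 F)) h4

end Candidates

/-! ## §3. The letter-free form 3ˢ «SIGN ∧ UPPER BOUND on SOME window»: `0 ≤ β ≤ β′` on `]0, γ₀]^{k+1}` for every `k`, some `γ₀ > 0` — equivalent to 3ʷ (shrink the window to kill the letter) -/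

section SignUpper

/-- A history in `]0, γ]^{k+1}` is in `]0, γ′]^{k+1}` for `γ ≤ γ′`. [folklore] -/
private theorem mem_box_mono {γ γ' : ℝ} (h : γ ≤ γ') {k : ℕ} {v : Fin (k + 1) → ℝ} (hv : v ∈ Box γ k) : v ∈ Box γ' k :=
  FlowStep.mem_box.mpr fun i => ⟨(FlowStep.mem_box.mp hv i).1, (FlowStep.mem_box.mp hv i).2.trans h⟩

/-- The shrunk window: `γ₁ := min γ₀ (min ½ (1 + |β′|)⁻¹)` is positive, `≤ γ₀`, `≤ ½`, and kills the 14d letter: `β′·γ₁² ≤ ¾` (`|β′|·(1+|β′|)⁻² ≤ ¼`). [folklore] -/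
private theorem shrink_window {γ₀ β' : ℝ} (hγ0 : 0 < γ₀) :
    ∃ γ₁ : ℝ, 0 < γ₁ ∧ γ₁ ≤ γ₀ ∧ γ₁ ≤ 1 / 2 ∧ β' * γ₁ ^ 2 ≤ 3 / 4 := by
  have ha : 0 < 1 + |β'| := by positivity
  refine ⟨min γ₀ (min (1 / 2) (1 + |β'|)⁻¹), lt_min hγ0 (lt_min (by norm_num) (inv_pos.mpr ha)), min_le_left _ _,
    (min_le_right _ _).trans (min_le_left _ _), ?_⟩
  set γ₁ := min γ₀ (min (1 / 2) (1 + |β'|)⁻¹) with hγ₁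
  have h0 : 0 ≤ γ₁ := (lt_min hγ0 (lt_min (by norm_num) (inv_pos.mpr ha))).le
  have h1 : γ₁ ≤ (1 + |β'|)⁻¹ := (min_le_right _ _).trans (min_le_right _ _)
  have h2 : γ₁ ≤ 1 / 2 := (min_le_right _ _).trans (min_le_left _ _)
  have h3 : γ₁ * (1 + |β'|) ≤ 1 := by
    calc γ₁ * (1 + |β'|) ≤ (1 + |β'|)⁻¹ * (1 + |β'|) := mul_le_mul_of_nonneg_right h1 ha.le
      _ = 1 := inv_mul_cancel₀ ha.ne'
  have h4 : |β'| * γ₁ ≤ 1 := by nlinarith [abs_nonneg β']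
  calc β' * γ₁ ^ 2 ≤ |β'| * γ₁ ^ 2 := by nlinarith [le_abs_self β', sq_nonneg γ₁]
    _ = (|β'| * γ₁) * γ₁ := by ring
    _ ≤ 1 * (1 / 2) := mul_le_mul h4 h2 h0 zero_le_one
    _ ≤ 3 / 4 := by norm_num

/-- **★ SIGN ∧ UPPER BOUND ON SOME WINDOW GIVE THE WINDOWED β-BOX** (for ANY family of β-functions): `BetaLowerH 0 γ₀ β ∧ BetaUpperH β′ γ₀ β`, `γ₀ > 0` ⟹ the 3ʷ-box on the shrunk window
`γ₁ = min γ₀ (min ½ (1+|β′|)⁻¹)` with `b = 0` and the letter `β′·γ₁² ≤ ¾` met by arithmetic — so the letter and the constant `b` of 3ʷ carry no content beyond the SIGN.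
[cite: Balaban1987RG1, §1 p.264; Balaban1989LargeFieldII, (1.4) p.357 (bookkeeping)] -/
theorem betaBoxW_of_sign_upper {β : HBeta} {γ₀ β' : ℝ} (hγ0 : 0 < γ₀) (hlow : BetaLowerH 0 γ₀ β) (hup : BetaUpperH β' γ₀ β) :
    ∃ γ b β₁ : ℝ, 0 < γ ∧ γ ≤ 1 / 2 ∧ 0 ≤ b ∧ β₁ * γ ^ 2 ≤ 3 / 4 ∧ BetaLowerH b γ β ∧ BetaUpperH β₁ γ β := by
  obtain ⟨γ₁, h0, h1, h2, h3⟩ := shrink_window (β' := β') hγ0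
  exact ⟨γ₁, 0, β', h0, h2, le_rfl, h3, (betaBox_restrict_of_le h1 hlow hup).1, (betaBox_restrict_of_le h1 hlow hup).2⟩

/-- … and conversely a windowed β-box with `0 ≤ b` gives sign ∧ upper bound on its window (so 3ˢ ⟺ 3ʷ pointwise). [cite: Balaban1987RG1, §1 p.264 (bookkeeping)] -/
theorem sign_upper_of_betaBoxW {β : HBeta} {γ b β' : ℝ} (hb : 0 ≤ b) (hlow : BetaLowerH b γ β) (hup : BetaUpperH β' γ β) :
    BetaLowerH 0 γ β ∧ BetaUpperH β' γ β :=
  ⟨fun k v hv => hb.trans (hlow k v hv), hup⟩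

/-- **THE SIGN STUB 3ˢ BODY AT `F` IMPLIES THE WINDOW STUB 3ʷ BODY AT `F`** (3ˢ: for every guarded constants tuple, SOME window `γ₀ > 0`, thresholds `ε₀, ε₂₉ > 0` and a bound `β′` with
`0 ≤ β₁₃(θ₁₅ᶜᶜᴹ(3)) ≤ β′` on `]0, γ₀]^{k+1}` for every `k` — the sign of [II] (1.4) and the «uniformly bounded» of [I] §1 p.264, on print's own «γ sufficiently small»).
[cite: Balaban1987RG1, Thm 1 p.259, §1 p.264; Balaban1989LargeFieldII, (1.4) p.357 (bookkeeping)] -/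
theorem stubW_of_stubS (F : T4Family)
    (h3S : ∀ B₃ B₃' a₀ a₁ : ℝ, 2 * (F.L : ℝ) ^ 2 ≤ B₃ → 0 < B₃' → 0 < a₀ → 0 < a₁ →
      VariationalThm1RegSepCoP7M F 2 B₃ a₀ a₁ →
      Gauge9RegSepTopStepR F 2 (fun ν K Ω => suppDomOfRecord F ν K Ω) (F.L ^ 3) ((11 * 4 + 3 * F.L) * F.L) B₃ B₃' a₀ a₁ →
      ∃ γ₀ ε₀ ε₂₉ β' : ℝ, 0 < γ₀ ∧ 0 < ε₀ ∧ 0 < ε₂₉ ∧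
        BetaLowerH 0 γ₀ (betaOfRecord₁₃ F 2 (theta13OfThm1CCM F 2 3 ε₀ ε₂₉ B₃ B₃' a₀ a₁)) ∧
        BetaUpperH β' γ₀ (betaOfRecord₁₃ F 2 (theta13OfThm1CCM F 2 3 ε₀ ε₂₉ B₃ B₃' a₀ a₁))) :
    ∀ B₃ B₃' a₀ a₁ : ℝ, 2 * (F.L : ℝ) ^ 2 ≤ B₃ → 0 < B₃' → 0 < a₀ → 0 < a₁ →
      VariationalThm1RegSepCoP7M F 2 B₃ a₀ a₁ →
      Gauge9RegSepTopStepR F 2 (fun ν K Ω => suppDomOfRecord F ν K Ω) (F.L ^ 3) ((11 * 4 + 3 * F.L) * F.L) B₃ B₃' a₀ a₁ →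
      ∃ γ ε₀ ε₂₉ b β' : ℝ, 0 < γ ∧ γ ≤ 1 / 2 ∧ 0 < ε₀ ∧ 0 < ε₂₉ ∧ 0 ≤ b ∧ β' * γ ^ 2 ≤ 3 / 4 ∧
        BetaLowerH b γ (betaOfRecord₁₃ F 2 (theta13OfThm1CCM F 2 3 ε₀ ε₂₉ B₃ B₃' a₀ a₁)) ∧
        BetaUpperH β' γ (betaOfRecord₁₃ F 2 (theta13OfThm1CCM F 2 3 ε₀ ε₂₉ B₃ B₃' a₀ a₁)) := by
  intro B₃ B₃' a₀ a₁ hB₃ hB₃' ha₀ ha₁ h15 h9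
  obtain ⟨γ₀, ε₀, ε₂₉, β', hγ0, hε, hε', hlow, hup⟩ := h3S B₃ B₃' a₀ a₁ hB₃ hB₃' ha₀ ha₁ h15 h9
  obtain ⟨γ, b, β₁, hγ, hγh, hb, hl, hlow', hup'⟩ := betaBoxW_of_sign_upper hγ0 hlow hup
  exact ⟨γ, ε₀, ε₂₉, b, β₁, hγ, hγh, hε, hε', hb, hl, hlow', hup'⟩

/-- **★★ THE V16 CANDIDATE, SIGN FORM — K0⁷'s BODY AT EVERY FAMILY from stub 1, stub 2, THE SIGN STUB 3ˢ («∃ γ₀ > 0, ∃ ε₀ ε₂₉ > 0, ∃ β′: 0 ≤ β₁₃(θ₁₅ᶜᶜᴹ(3)) ≤ β′ on every `]0, γ₀]^{k+1}`»,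
given the guards and the two R-tokens) and stub 4** (3ˢ ⇒ 3ʷ ⇒ 3ᶜ ∘ the clause form).  Hypothesis form, no `sorry`.  3ˢ IS NODE O's leaf at the K0 witness in print's vocabulary: the SIGN
([II] p.355 ∕ (1.4), UNPRINTED — T09.F) and «uniformly bounded» ([I] §1 p.264), on a window of ITS choosing. [cite: Balaban1985Variational, Thm 1 (8)–(9) p.279, (152) p.301, Prop. 8 p.304; Balaban1985RegularSpaces, Prop. 6 p.99; Balaban1988Convergent, Thm 1 p.262, (2.6)–(2.8) pp.255–256, (3.16)–(3.23) pp.268–270; Balaban1987RG1, Thm 1 p.259, (0.20) p.256, (1.20)–(1.22) p.264, §1 p.264; Balaban1989LargeFieldII, (1.4) p.357; Balaban1989LargeFieldI, (0.2)–(0.4) p.176] -/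
theorem record13SepCoPHBody_of_stubsS
    (h1 : ∀ F : T4Family, ∃ B₃ a₀ a₁ : ℝ, 2 * (F.L : ℝ) ^ 2 ≤ B₃ ∧ 0 < a₀ ∧ 0 < a₁ ∧
      Prop8RegSepTopStep F 2 (fun ν K Ω => suppDomOfRecord F ν K Ω) B₃ a₀ a₁)
    (h2 : ∀ F : T4Family, ∃ B₁ c₁ : ℝ, 0 ≤ B₁ ∧ 0 < c₁ ∧
      (letI : CStarAlgebra (MatA 2) := {}; B8.Prop6Printed 4 (F.L : ℝ) B₁ c₁ (fun i : B8LeafModelZd.ZdIdx 4 F.L => zdCub (MatA 2) F.L i)))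
    (h3S : ∀ (F : T4Family) (B₃ B₃' a₀ a₁ : ℝ), 2 * (F.L : ℝ) ^ 2 ≤ B₃ → 0 < B₃' → 0 < a₀ → 0 < a₁ →
      VariationalThm1RegSepCoP7M F 2 B₃ a₀ a₁ →
      Gauge9RegSepTopStepR F 2 (fun ν K Ω => suppDomOfRecord F ν K Ω) (F.L ^ 3) ((11 * 4 + 3 * F.L) * F.L) B₃ B₃' a₀ a₁ →
      ∃ γ₀ ε₀ ε₂₉ β' : ℝ, 0 < γ₀ ∧ 0 < ε₀ ∧ 0 < ε₂₉ ∧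
        BetaLowerH 0 γ₀ (betaOfRecord₁₃ F 2 (theta13OfThm1CCM F 2 3 ε₀ ε₂₉ B₃ B₃' a₀ a₁)) ∧
        BetaUpperH β' γ₀ (betaOfRecord₁₃ F 2 (theta13OfThm1CCM F 2 3 ε₀ ε₂₉ B₃ B₃' a₀ a₁)))
    (h4 : ∀ F : T4Family, F.m ≤ 3 → ∃ θ : Stage13HParams F 2, θ.Provisos₁₃SepCoPH F 2 ∧ (θ.ZhUnity F 2 ∧ θ.SlotsNondegenerate₁₃ F 2) ∧ θ.Admissible F 2) :
    ∀ F : T4Family, ∃ θ : Stage13HParams F 2, θ.Provisos₁₃SepCoPH F 2 ∧ (θ.ZhUnity F 2 ∧ θ.SlotsNondegenerate₁₃ F 2) ∧ θ.Admissible F 2 :=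
  record13SepCoPHBody_of_stubsW h1 h2 (fun F => stubW_of_stubS F (h3S F)) h4

/-- **★ THE TREE's OWN NAME FOR THE LEAF**: `FlowStep.BetaSignH β` (`∃ γ₀ > 0, BetaLowerH 0 γ₀ β` — T09.F, weak form, FlowStep.lean §5) together with «uniformly bounded on SOME window»
(`∃ γ₁ > 0, ∃ β′, BetaUpperH β′ γ₁ β`) give the windowed β-box (common window `min γ₀ γ₁`, then §3's shrink). [cite: Balaban1987RG1, §1 p.264; Balaban1989LargeFieldII, (1.4) p.357 (bookkeeping)] -/
theorem betaBoxW_of_betaSignH_of_upper {β : HBeta} (hsign : BetaSignH β) (hup : ∃ γ₁ β' : ℝ, 0 < γ₁ ∧ BetaUpperH β' γ₁ β) :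
    ∃ γ b β₁ : ℝ, 0 < γ ∧ γ ≤ 1 / 2 ∧ 0 ≤ b ∧ β₁ * γ ^ 2 ≤ 3 / 4 ∧ BetaLowerH b γ β ∧ BetaUpperH β₁ γ β := by
  obtain ⟨γ₀, hγ0, hlow⟩ := hsign
  obtain ⟨γ₁, β', hγ1, hup⟩ := hup
  have hlow' : BetaLowerH 0 (min γ₀ γ₁) β := fun k v hv => hlow k v (mem_box_mono (min_le_left _ _) hv)
  have hup' : BetaUpperH β' (min γ₀ γ₁) β := fun k v hv => hup k v (mem_box_mono (min_le_right _ _) hv)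
  exact betaBoxW_of_sign_upper (lt_min hγ0 hγ1) hlow' hup'

/-- **THE T09.F STUB 3ᵀ BODY AT `F` IMPLIES THE SIGN STUB 3ˢ BODY AT `F`** (3ᵀ: for every guarded constants tuple SOME thresholds `ε₀, ε₂₉ > 0` with `BetaSignH (β₁₃(θ₁₅ᶜᶜᴹ(3)))` — the
tree's name for the unprinted sign leaf — and «uniformly bounded on some window»; common window `min γ₀ γ₁`). [cite: Balaban1987RG1, §1 p.264; Balaban1989LargeFieldII, (1.4) p.357 (bookkeeping)] -/
theorem stubS_of_stubT (F : T4Family)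
    (h3T : ∀ B₃ B₃' a₀ a₁ : ℝ, 2 * (F.L : ℝ) ^ 2 ≤ B₃ → 0 < B₃' → 0 < a₀ → 0 < a₁ →
      VariationalThm1RegSepCoP7M F 2 B₃ a₀ a₁ →
      Gauge9RegSepTopStepR F 2 (fun ν K Ω => suppDomOfRecord F ν K Ω) (F.L ^ 3) ((11 * 4 + 3 * F.L) * F.L) B₃ B₃' a₀ a₁ →
      ∃ ε₀ ε₂₉ : ℝ, 0 < ε₀ ∧ 0 < ε₂₉ ∧
        BetaSignH (betaOfRecord₁₃ F 2 (theta13OfThm1CCM F 2 3 ε₀ ε₂₉ B₃ B₃' a₀ a₁)) ∧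
        ∃ γ₁ β' : ℝ, 0 < γ₁ ∧ BetaUpperH β' γ₁ (betaOfRecord₁₃ F 2 (theta13OfThm1CCM F 2 3 ε₀ ε₂₉ B₃ B₃' a₀ a₁))) :
    ∀ B₃ B₃' a₀ a₁ : ℝ, 2 * (F.L : ℝ) ^ 2 ≤ B₃ → 0 < B₃' → 0 < a₀ → 0 < a₁ →
      VariationalThm1RegSepCoP7M F 2 B₃ a₀ a₁ →
      Gauge9RegSepTopStepR F 2 (fun ν K Ω => suppDomOfRecord F ν K Ω) (F.L ^ 3) ((11 * 4 + 3 * F.L) * F.L) B₃ B₃' a₀ a₁ →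
      ∃ γ₀ ε₀ ε₂₉ β' : ℝ, 0 < γ₀ ∧ 0 < ε₀ ∧ 0 < ε₂₉ ∧
        BetaLowerH 0 γ₀ (betaOfRecord₁₃ F 2 (theta13OfThm1CCM F 2 3 ε₀ ε₂₉ B₃ B₃' a₀ a₁)) ∧
        BetaUpperH β' γ₀ (betaOfRecord₁₃ F 2 (theta13OfThm1CCM F 2 3 ε₀ ε₂₉ B₃ B₃' a₀ a₁)) := by
  intro B₃ B₃' a₀ a₁ hB₃ hB₃' ha₀ ha₁ h15 h9
  obtain ⟨ε₀, ε₂₉, hε, hε', ⟨γ₀, hγ0, hlow⟩, γ₁, β', hγ1, hup⟩ := h3T B₃ B₃' a₀ a₁ hB₃ hB₃' ha₀ ha₁ h15 h9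
  exact ⟨min γ₀ γ₁, ε₀, ε₂₉, β', lt_min hγ0 hγ1, hε, hε', fun k v hv => hlow k v (mem_box_mono (min_le_left _ _) hv),
    fun k v hv => hup k v (mem_box_mono (min_le_right _ _) hv)⟩

/-- **★★ THE V16 CANDIDATE, T09.F FORM — K0⁷'s BODY AT EVERY FAMILY from stub 1, stub 2, THE T09.F STUB 3ᵀ («∃ ε₀ ε₂₉ > 0, `BetaSignH (β₁₃(θ₁₅ᶜᶜᴹ(3)))` ∧ ∃ γ₁ > 0, ∃ β′,
`BetaUpperH β′ γ₁ (β₁₃(θ₁₅ᶜᶜᴹ(3)))`», given the guards and the two R-tokens) and stub 4** (3ᵀ ⇒ 3ˢ ⇒ 3ʷ ⇒ 3ᶜ).  Hypothesis form, no `sorry`.  3ᵀ names the leaf BY THE TREE's NAME: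
`FlowStep.BetaSignH` (T09.F weak form, UNPRINTED) ∧ [I] §1 p.264 «uniformly bounded». [cite: Balaban1985Variational, Thm 1 (8)–(9) p.279, (152) p.301, Prop. 8 p.304; Balaban1985RegularSpaces, Prop. 6 p.99; Balaban1988Convergent, Thm 1 p.262, (2.6)–(2.8) pp.255–256, (3.16)–(3.23) pp.268–270; Balaban1987RG1, Thm 1 p.259, (0.20) p.256, (1.20)–(1.22) p.264, §1 p.264; Balaban1989LargeFieldII, (1.4) p.357; Balaban1989LargeFieldI, (0.2)–(0.4) p.176] -/
theorem record13SepCoPHBody_of_stubsT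
    (h1 : ∀ F : T4Family, ∃ B₃ a₀ a₁ : ℝ, 2 * (F.L : ℝ) ^ 2 ≤ B₃ ∧ 0 < a₀ ∧ 0 < a₁ ∧
      Prop8RegSepTopStep F 2 (fun ν K Ω => suppDomOfRecord F ν K Ω) B₃ a₀ a₁)
    (h2 : ∀ F : T4Family, ∃ B₁ c₁ : ℝ, 0 ≤ B₁ ∧ 0 < c₁ ∧
      (letI : CStarAlgebra (MatA 2) := {}; B8.Prop6Printed 4 (F.L : ℝ) B₁ c₁ (fun i : B8LeafModelZd.ZdIdx 4 F.L => zdCub (MatA 2) F.L i)))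
    (h3T : ∀ (F : T4Family) (B₃ B₃' a₀ a₁ : ℝ), 2 * (F.L : ℝ) ^ 2 ≤ B₃ → 0 < B₃' → 0 < a₀ → 0 < a₁ →
      VariationalThm1RegSepCoP7M F 2 B₃ a₀ a₁ →
      Gauge9RegSepTopStepR F 2 (fun ν K Ω => suppDomOfRecord F ν K Ω) (F.L ^ 3) ((11 * 4 + 3 * F.L) * F.L) B₃ B₃' a₀ a₁ →
      ∃ ε₀ ε₂₉ : ℝ, 0 < ε₀ ∧ 0 < ε₂₉ ∧
        BetaSignH (betaOfRecord₁₃ F 2 (theta13OfThm1CCM F 2 3 ε₀ ε₂₉ B₃ B₃' a₀ a₁)) ∧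
        ∃ γ₁ β' : ℝ, 0 < γ₁ ∧ BetaUpperH β' γ₁ (betaOfRecord₁₃ F 2 (theta13OfThm1CCM F 2 3 ε₀ ε₂₉ B₃ B₃' a₀ a₁)))
    (h4 : ∀ F : T4Family, F.m ≤ 3 → ∃ θ : Stage13HParams F 2, θ.Provisos₁₃SepCoPH F 2 ∧ (θ.ZhUnity F 2 ∧ θ.SlotsNondegenerate₁₃ F 2) ∧ θ.Admissible F 2) :
    ∀ F : T4Family, ∃ θ : Stage13HParams F 2, θ.Provisos₁₃SepCoPH F 2 ∧ (θ.ZhUnity F 2 ∧ θ.SlotsNondegenerate₁₃ F 2) ∧ θ.Admissible F 2 :=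
  record13SepCoPHBody_of_stubsS h1 h2 (fun F => stubS_of_stubT F (h3T F)) h4

end SignUpper

end Summit.QuantumFields.YangMills.Theorems.K0WindowOfStepTokensRCube

end
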